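import Summits.AnomalousDissipation.AnomalousDissipation.Theorems.BaireTransferDenseLoudDesignerForcesLine
import Summits.AnomalousDissipation.AnomalousDissipation.Theorems.BaireTransferDenseLoudDesignerForcesStubGalileanCovariance
import Summits.AnomalousDissipation.AnomalousDissipation.Theorems.BaireTransferDenseLoudDesignerForcesStubBoostBudgets
import Summits.AnomalousDissipation.AnomalousDissipation.Theorems.BaireTransferDenseLoudDesignerForcesStubGoodDrift
import Summits.AnomalousDissipation.AnomalousDissipation.Theorems.DenseLoudDesignerForces.Negative.FalseWithoutConvection
import Summits.AnomalousDissipation.AnomalousDissipation.Theorems.DenseLoudDesignerForces.Negative.BandLimited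
import Summits.AnomalousDissipation.AnomalousDissipation.Theorems.DenseLoudDesignerForces.Negative.Scaling
import Summits.AnomalousDissipation.AnomalousDissipation.Theorems.DenseLoudDesignerForces.Negative.Planar
import Literature.Analysis.FluidPDE.LongTimeAveragePeriodic
import HarnessLib.Audit

/-!
# Line `galilean-detuning-body-force-grid` — LEAD'S SKELETON v4 for crux `BaireTransfer.DenseLoudDesignerForces`
(item stmt-AnomalousDissipation-1143, route route-AnomalousDissipation-BaireTransfer; lead prover-line-stmt-AnomalousDissipation-1143-c2-0,
continuing lead -0's v2)

v4 (2026-08-16, lead c2-0, 14:10Z): the residual is weakened once more, from ONE drift per level (v3's `stub_driftLoudness`)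
to ONE DRIFT PER WITNESS — `stub_driftClassLoudness`: at every level the window is in the closure of the UNION of the swept loud
sets over all drift energies `E_V > 0`, lattice labels `n ≠ 0` and splits `E_V + E_w ≤ E`.  This is exactly what the transport
lemma consumes (it is applied point by point), it is implied by v3's residual, and by the landed drift dictionary
(`Theorems/BaireTransferDenseLoudDesignerForcesDriftDictionary.lean`, p106854 + its §6) it is EQUIVALENT to the crux with the
witness class restricted, witness by witness, to periodic classical solutions with non-zero constant mean momentum `V` and a
period `T` with `T • V ∈ ℤ³` (`DenseLoudDesignerForcesDriftClass`) — the weakest statement this line can reduce the crux to.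

v3 (2026-08-16, lead c2-0): RESHAPE OF THE RESIDUAL TO ITS WEAKEST COMPOSITION-SUFFICIENT FORM.  v2's residual
`stub_gridLoudness` asked swept loud sets to be dense in ONE window for EVERY good drift `n ∈ goodDrifts S κ c₀` beyond a
level-dependent scale, for EVERY `κ, c₀ > 0`, with ONE energy split `(E_V, E_w)` for all levels — strictly more than the
composition consumes (`isWindow_glue` uses one good drift per level; lead -0's promote note, drefute N1/N2).  v3's residual
`stub_driftLoudness` asks exactly what the transport lemma `mem_loudSet_of_swept_witness` (landed, p76475) needs and nothing
more: PER LEVEL `j`, SOME non-zero lattice drift `n` and SOME split `E_V + E_w ≤ E` (`E_V > 0`) with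
`U ⊆ closure (sweptLoudSet S E_w ε E_V n j)`.  The good-drift arithmetic (`goodDrifts`, `stub_goodDrift`, landed p83076)
leaves the logical path — it remains the line's PHYSICS (which drifts detune the laminar runaway: certified M1, p85696) and a
landed support, not a hypothesis of the composition.  The composition `DenseLoudDesignerForces_of` below is sorry-free glue in
this file: `crux_iff` + `stub_driftLoudness` + `closure_mono` ∘ `mem_loudSet_of_swept_witness stub_galileanCovariance
stub_boostBudgets`; sorries only in `stub_driftLoudness`.

What the line reduces the crux to (lead c2-0's reading, to be certified as a two-sided dictionary in a support file): by
`galilean_unboost`/`galilean_boost_general` (p83890) `c ∈ sweptLoudSet S E_w ε E_V n j` iff the STEADY designer force `f_c`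
carries, at some `ν < 1/(j+1)`, a lab-frame classical solution `u` with constant mean momentum `driftVel E_V n`
(`‖·‖² = E_V`, direction `n`), lab period `driftPeriod E_V n = ‖n‖/√E_V` (so that the drift is lattice-commensurate),
fluctuation energy `⟨‖u - V‖²⟩ ≤ E_w` and dissipation `≥ ε`.  Hence `stub_driftLoudness` is the crux RESTRICTED to witnesses
with non-zero lattice-commensurate mean momentum and commensurate period: a mild strengthening of the crux itself.  The line
selects WHERE loud orbits should be sought (drift class, no laminar runaway); it does not reduce WHAT must be proved (the zeroth
law on periodic orbits).  Necessary conditions every witness satisfies: drefute N1 (Doppler ceiling, certified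
`Negative/DopplerCeiling(Drift).lean`: `ε κ √E_V ≤ √3‖c‖₁E_w + (ν/2)(E_w + Λ₂(c')²)`), N2 (period structure), and the whole
Disproof target sheet (§3–§18) transported by the true stubs.

Stubs: `stub_galileanCovariance` (LANDED p78980), `stub_boostBudgets` (LANDED p80760), `stub_driftClassLoudness` (XL, THE RESIDUAL —
the only `sorry`; held by the lead).  `stub_goodDrift` (LANDED p83076) is kept in §1 as a landed support (not in the composition).
History: v1 planner (crux-plan round 2; triage r2-1/2/3 pass ×3), v2 lead -0 (four stubs, three landed, residual promoted 06:38Z).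
-/

set_option linter.dupNamespace false

noncomputable section

open scoped BigOperators Topology InnerProductSpace
open Filter Set Function MeasureTheory

namespace Summit.AnomalousDissipation.AnomalousDissipation.Cruxes.DenseLoudDesignerForces.GalileanDetuningBodyForceGrid

open Literature.Analysis.FunctionSpaces Literature.Analysis.FluidPDE
open Summit.AnomalousDissipation.AnomalousDissipation.Theses.BaireTransfer
open Summit.AnomalousDissipation.AnomalousDissipation.Theorems.DenseLoudDesignerForces.Negative
open Summit.AnomalousDissipation.AnomalousDissipation.Theorems.DenseLoudDesignerForces.Galilean

/-- The flat unit torus `T³`. -/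
local notation "𝕋³" => UnitAddTorus (Fin 3)
/-- Real velocity values. -/
local notation "ℝ³" => EuclideanSpace ℝ (Fin 3)
/-- Complex Fourier coefficient values. -/
local notation "ℂ³" => EuclideanSpace ℂ (Fin 3)
/-- The frequency / drift lattice `ℤ³`. -/
local notation "ℤ³" => Fin 3 → ℤ

/-! ## §0 Sanity: the crux through the landed vocabulary (definitional) -/

example :
    DenseLoudDesignerForces ↔
      ∀ S₀ : Finset ℤ³, ∃ S : Finset ℤ³, S₀ ⊆ S ∧ ∃ (E ε : ℝ), 0 < ε ∧
        ∃ U : Set (↥S → ℂ³), IsWindow S E ε U :=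
  crux_iff

/-! ## §1 Registered stubs (signatures byte-identical to the registration) -/

/-- **stub_galileanCovariance** (size M–L; TRUE: exact identity).  Galilean covariance of classical
Navier–Stokes solutions on `ℝ × T³` under a uniformly moving frame: swept-force solutions boost to
steady-force solutions.  Proof route with tree material: `Torus.IsSmoothSpaceTimeOn` of the composite with the
affine map `(t, x̃) ↦ (t, x̃ - tV)` (`stLift (boost V w) (t,x̃) = V + stLift w (t, x̃ - tV)`); chain rule for
`timeDerivWithin univ = deriv` giving `∂ₜw(t)(y) - Torus.fderiv (w t) y V` at `y = x - [tV]`;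
`Torus.convect (u t) (u t) x = Torus.fderiv (w t) y (V + w t y)` (derivative of a translate, constants drop);
`Torus.laplacian`/`Torus.gradient`/`Torus.divergence` of translates (`liftAt (g ∘ (· - a)) x = liftAt g (x - a)`).
Nearest tree lemma: `translate_isClassical` (Cruxes/RobustLoudUpgrade/Disproof.lean §11, static translations).
Leans on: `Torus.IsClassicalNSSolutionOn` (TorusFluidGlue:151), `Torus.timeDerivWithin`, `Torus.convect`,
`Torus.proj_add`; Mathlib `HasDerivAt.comp`, `fderiv` of translations. -/
theorem stub_galileanCovariance :
    ∀ (ν : ℝ) (V : ℝ³) (F : 𝕋³ → ℝ³) (w : ℝ → 𝕋³ → ℝ³) (q : ℝ → 𝕋³ → ℝ),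
      Torus.IsClassicalNSSolutionOn Set.univ ν (sweptForce V F) w q →
        Torus.IsClassicalNSSolutionOn Set.univ ν (fun _ => F) (boost V w) (boostScalar V q) := by
  -- LANDED (p78980, Theorems/BaireTransferDenseLoudDesignerForcesStubGalileanCovariance.lean)
  exact Covariance.stub_galileanCovariance

/-- **stub_boostBudgets** (size M; TRUE: exact identities).  Energy and dissipation bookkeeping of a
lattice-commensurate boost of a smooth periodic momentum-free fluctuation.  Proof route: `boost V w` is
`T`-periodic (`boost_periodic` below), so both means are period means (`meanEnergy_eq_of_periodic`,
`meanDissipation_eq_of_periodic`, LongTimeAveragePeriodic:157/169); slice-wise `∫‖V + w t (x - a)‖² dx =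
∫‖V + w t x‖² dx` (Haar: `MeasureTheory.integral_sub_right_eq_self` on the compact group `T³`) `= ‖V‖² +
2⟪V, ∫ w t⟫ + ∫‖w t‖²` (`integral_inner`, probability measure, `HasZeroMean`) and interval-integrability of the
continuous slice energy (smoothness) to split `∫₀ᵀ`; `Torus.eGradNormSq (boost V w t) = Torus.eGradNormSq (w t)`
from `mFourierCoeff` of a translate (`= e^{-2πik·a} ŵ(k)`) and of a constant (supported at `k = 0`, weight `0`).
Leans on: `meanEnergy`/`meanDissipation` (ZerothLaw:146/154), `Torus.eGradNormSq` (TorusFluidGlue:110),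
`TorusFourierCalculus`, Mathlib Haar invariance on `UnitAddTorus`. -/
theorem stub_boostBudgets :
    ∀ (ν : ℝ) (V : ℝ³) (n : ℤ³) (T : ℝ) (w : ℝ → 𝕋³ → ℝ³), 0 < T → T • V = Torus.latticeVec n →
      Torus.IsSmoothSpaceTimeOn Set.univ w → Function.Periodic w T → (∀ t, Torus.HasZeroMean (w t)) →
        meanEnergy (boost V w) = ‖V‖ ^ 2 + meanEnergy w ∧
          meanDissipation ν (boost V w) = meanDissipation ν w := by
  -- LANDED (p80760, Theorems/BaireTransferDenseLoudDesignerForcesStubBoostBudgets.lean)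
  exact BoostBudgets.stub_boostBudgets

/-- **stub_goodDrift** (size M–L; TRUE: elementary geometry of numbers).  For every finite `S ⊆ ℤ³` there are
`κ, c₀ > 0` with good drifts at every scale.  Proof route (explicit family): pick a primitive `p ∈ ℤ³` off the
finitely many planes `k^⊥`, `k ∈ S ∖ {0}` (a finite union of planes does not cover `ℤ³`), an integer basis
`f₁, f₂` of `p^⊥ ∩ ℤ³` (`f₁ × f₂ = ±p`) and small integer `w₁, w₂`; put `b₁ = a f₁ + w₁`, `b₂ = a f₂ + w₂`,
`n_a = b₁ × b₂ = a²p + a s + r`.  Then `b₁, b₂ ⊥ n_a`, `‖b_i‖ ≍ a ≍ ‖n_a‖^{1/2}`, the angle of `(b₁, b₂)` tends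
to that of `(f₁, f₂)`, so every non-zero vector of `ℤb₁ + ℤb₂` has norm `≥ c a`; arranging `gcd(n_a) = 1`
(choice of `w₁, w₂` / of `a` in a residue class) makes `{b₁, b₂}` a basis of `n_a^⊥ ∩ ℤ³`, whence
`λ₁(n_a^⊥ ∩ ℤ³)² ≥ c₀‖n_a‖`; and `|k·n_a| ≥ a²|k·p| - O(a‖k‖) ≥ κ‖k‖‖n_a‖` for `a` large with
`κ = min_{k ∈ S∖{0}} |k·p|/(2‖k‖‖p‖)`.  Alternative: counting — among the `≍ R³` lattice points of a fixed
non-resonant cone at scale `R`, those with a resonant `k`, `‖k‖² < c₀R`, number `≲ Σ_{‖k‖² < c₀R} (R²/‖k‖ + R)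
≲ c₀R³`.  Leans on: `Torus.latticeVec(_apply)` (FlatTorus:147), Mathlib `Finset`/`Int` arithmetic,
`crossProduct` (Mathlib `Mathlib.LinearAlgebra.CrossProduct`). -/
theorem stub_goodDrift :
    ∀ S : Finset ℤ³, ∃ κ : ℝ, 0 < κ ∧ ∃ c₀ : ℝ, 0 < c₀ ∧
      ∀ N : ℕ, ∃ n : ℤ³, n ∈ goodDrifts S κ c₀ ∧ (N : ℝ) ≤ ‖Torus.latticeVec n‖ := by
  -- LANDED (p83076, Theorems/BaireTransferDenseLoudDesignerForcesStubGoodDrift.lean)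
  exact GoodDrift.stub_goodDrift

/-- **stub_driftClassLoudness** (size XL; THE RESIDUAL in its weakest composition-sufficient form — honestly crux-sized; held
by the lead).  DRIFT-CLASS ZEROTH LAW, designer/density form, one drift PER WITNESS: for every finite stock `S₀` there are
`S ⊇ S₀`, budgets `E`, `ε > 0` and a non-empty open `U ⊆ P_S` such that at every level `j` the union over all drift
energies `E_V > 0`, lattice labels `n ≠ 0` and splits `E_V + E_w ≤ E` of the swept loud sets `sweptLoudSet S E_w ε E_V n j`
(coefficient vectors whose swept force `f_c(y + t·driftVel E_V n)` carries, at some `ν < 1/(j+1)`, a momentum-free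
`driftPeriod E_V n`-periodic classical fluctuation with `meanEnergy ≤ E_w`, `meanDissipation ≥ ε`) is dense in `U`.
Equivalent lab reading (landed dictionary, `driftClassLoudness_iff_denseLoudDesignerForcesDriftClass`): the crux
`DenseLoudDesignerForces` with witnesses restricted to periodic classical solutions with non-zero constant mean momentum
`V` and a period `T` with `T • V ∈ ℤ³` (`DenseLoudDesignerForcesDriftClass`).  For `V` of rational direction these are
exactly the periodic points of the stroboscopic map of the swept (time-periodically forced) system; the mean momentum is a
free conserved quantity of the lab dynamics, so the restriction is to a natural, non-uniform witness class — and the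
statement remains the zeroth law on periodic orbits.  Intended construction / plausibility / failure modes: v2 docstring of
`stub_gridLoudness` (tree history) and the line card; necessary conditions: drefute N1 (Doppler ceiling, certified
`Negative/DopplerCeiling(Drift).lean`), N2 (period structure), Disproof §3–§18.  USES the `_false_without_convection`
hypothesis here and only here.
Leans on: `sweptLoudSet`, `driftVel`, `driftPeriod` (Theorems/BaireTransferDenseLoudDesignerForcesLine.lean); literature NOT in
tree and NOT sufficient even if it were (Prodi 1960 / Kyed–Galdi: periodic WEAK solutions with the laminar energy bound only;
Iooss 1972 / Chossat–Iooss 1994 equivariant Hopf: QUIET small-amplitude branches; UPO evidence van Veen–Kida–Kawahara 2006,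
van Veen–Vela-Martín–Kawahara 2019: numerical). -/
theorem stub_driftClassLoudness :
    ∀ S₀ : Finset ℤ³, ∃ S : Finset ℤ³, S₀ ⊆ S ∧ ∃ (E ε : ℝ), 0 < ε ∧
      ∃ U : Set (↥S → ℂ³), IsOpen U ∧ U.Nonempty ∧
        ∀ j : ℕ, U ⊆ closure {c | ∃ (EV Ew : ℝ) (n : ℤ³), 0 < EV ∧ n ≠ 0 ∧ EV + Ew ≤ E ∧
          c ∈ sweptLoudSet S Ew ε EV n j} := by
  sorry

/-! ## §2 Composition (sorry-free): the three stubs prove the crux BY NAME -/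

/-- **Composition: the registered stubs prove the crux `DenseLoudDesignerForces` BY NAME.**  For `S₀` take
`S, E, ε, U` from `stub_driftClassLoudness`; at level `j` transport each point of the dense union — with ITS drift `n ≠ 0`
and split `E_V + E_w ≤ E` — into `LOUD_j(S, E, ε)` by the landed transport lemma `Galilean.mem_loudSet_of_swept_witness`
fed with `stub_galileanCovariance` and `stub_boostBudgets`, then `closure_mono`; conclude by `crux_iff`
(`Negative.denseLoudDesignerForces_iff`, `Iff.rfl`).  Sorries only inside `stub_*`.  (Equivalently:
`DriftDictionary.denseLoudDesignerForces_of_driftClassLoudness stub_driftClassLoudness`, once §6 of the dictionary lands.) -/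
theorem DenseLoudDesignerForces_of :
    Summit.AnomalousDissipation.AnomalousDissipation.Theses.BaireTransfer.DenseLoudDesignerForces := by
  refine crux_iff.2 fun S₀ => ?_
  obtain ⟨S, hS, E, ε, hε, U, hU, hne, hlev⟩ := stub_driftClassLoudness S₀
  refine ⟨S, hS, E, ε, hε, U, hU, hne, fun j => (hlev j).trans (closure_mono ?_)⟩
  rintro c ⟨EV, Ew, n, hEV, hn, hE, hc⟩
  exact mem_loudSet_of_swept_witness stub_galileanCovariance stub_boostBudgets hEV hn hE hc

/-- The earlier residuals imply the present one: v2's `stub_gridLoudness` (with the landed `stub_goodDrift`) ⇒ v3's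
one-drift-per-level form ⇒ v4's `stub_driftClassLoudness` — recorded sorry-free so that each reshape is visibly a weakening. -/
theorem stub_driftClassLoudness_of_gridLoudness
    (hgrid : ∀ S₀ : Finset ℤ³, ∃ S : Finset ℤ³, S₀ ⊆ S ∧
      ∀ κ : ℝ, 0 < κ → ∀ c₀ : ℝ, 0 < c₀ →
        ∃ (EV Ew ε : ℝ), 0 < EV ∧ 0 < ε ∧ ∃ (N₀ : ℕ → ℕ) (U : Set (↥S → ℂ³)), IsOpen U ∧ U.Nonempty ∧
          ∀ (j : ℕ) (n : ℤ³), n ∈ goodDrifts S κ c₀ → ((N₀ j : ℕ) : ℝ) ≤ ‖Torus.latticeVec n‖ →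
            U ⊆ closure (sweptLoudSet S Ew ε EV n j)) :
    ∀ S₀ : Finset ℤ³, ∃ S : Finset ℤ³, S₀ ⊆ S ∧ ∃ (E ε : ℝ), 0 < ε ∧
      ∃ U : Set (↥S → ℂ³), IsOpen U ∧ U.Nonempty ∧
        ∀ j : ℕ, U ⊆ closure {c | ∃ (EV Ew : ℝ) (n : ℤ³), 0 < EV ∧ n ≠ 0 ∧ EV + Ew ≤ E ∧
          c ∈ sweptLoudSet S Ew ε EV n j} := by
  intro S₀
  obtain ⟨S, hS, hgridS⟩ := hgrid S₀
  obtain ⟨κ, hκ, c₀, hc₀, hgood⟩ := stub_goodDrift S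
  obtain ⟨EV, Ew, ε, hEV, hε, N₀, U, hU, hUne, hdense⟩ := hgridS κ hκ c₀ hc₀
  refine ⟨S, hS, EV + Ew, ε, hε, U, hU, hUne, fun j => ?_⟩
  obtain ⟨n, hgoodn, hnN⟩ := hgood (N₀ j)
  exact (hdense j n hgoodn hnN).trans (closure_mono fun c hc => ⟨EV, Ew, n, hEV, hgoodn.1, le_rfl, hc⟩)

/-! ## §3 Disproof obligations in scope (landed `Negative/*` lemmas the stubs are checked against) -/

-- [D§7] the convective term is load-bearing: with Stokes witnesses the crux is false — honoured by
-- `stub_driftClassLoudness` (the swept linear response is the quiet Oseen–Stokes witness).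
example : ¬ DenseLoudDesignerForcesWithoutConvection := denseLoudDesignerForces_false_without_convection

-- [D§9] band-limited witnesses are quiet: the residual's witnesses must escape every Fourier band.
example := @bandLoudSet_eq_empty

-- [D§10] scale covariance / Grashof form of the loud set (no free level from rescaling one orbit).
example := @mem_loudSet_iff_unit_viscosity

-- [D§12] the planar analogue of the crux is false: good drifts and witnesses are genuinely 3-D.
example : ¬ DenseLoudDesignerForcesPlanar := denseLoudDesignerForces_false_planar

end Summit.AnomalousDissipation.AnomalousDissipation.Cruxes.DenseLoudDesignerForces.GalileanDetuningBodyForceGrid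

end
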